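/-
Copyright (c) 2026 the pub-hodgecm-mathlib formalisation cell (harness21).  Prover seat hodgecm-mathlib-K2E1-p11 (g4), Track B ∕ K2-LIT, h413 = `stmt-HodgeConjecture-24833`,
R90-TF section S8 «ContSpec-n½», #2 road (G side), S8 dealer R90-CS-plan (g3) S8-R136 (3) ∕ S8-R151 (1) «NON-ZERO SECTION WITNESS AT A LEVEL», FILE 2b of the census
`R90/S8/CENSUS-ChiSectionPairNonzeroWitness.K2E1-p11-g4.md` f84e71c9c4f7f19b: THE CONDUCTOR LEVEL — an open `K_f ≤ G(𝔸_f)` on whose Borel elements the pair character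
`χ₁(k₀₀)·χ₂(k₁₁)` is trivial (no small subgroups of `ℂˣ` ★ + the principal finite congruence levels as a basis of `1` ★), and THE LEVEL-FREE WITNESS
`∃ K′ ω φ, φ ∈ chiSectionSpacePair χ₁ χ₂ K′ ω ∧ Continuous φ ∧ φ 1 ≠ 0` from unitarity of `(χ₁, χ₂)` alone (★ FILE 3c at that level).
-/
import Summits.HodgeConjecture.HodgeConjecture.Theorems.R90S8ChiSectionPairArchSectionWitnessU3   -- ★ (this seat) FILE 3c: `exists_chiSectionPair_continuous_apply_one_ne_zero_of_level`; brings FILE 2 ∕ FILE 1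
import Literature.NumberTheory.Automorphic.UnitaryGroupLevelBasis                              -- ★ `exists_finCongruenceLevel_subset`, `isOpen_finCongruenceLevel`, `Complex.exists_nhds_one_forall_pow_mem_imp`
import HarnessLib

/-!
# S8 #2 road (G side) — `R90S8ChiSectionPairConductorLevelU3`: a conductor level for the Borel pair character, and THE LEVEL-FREE NON-ZERO `(χ₁,χ₂)`-SECTION

WHAT THIS FILE DOES.
* §1 On `B(𝔸) ≤ U(2,1)(𝔸_{L⁺})` (subspace topology) the diagonal ideles `b ↦ bᵢᵢ` are continuous INTO `𝔸_Lˣ` (entries of `b` and `b⁻¹`), hence so is the Borel pair character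
  `θ(b) := χ₁(b₀₀)·χ₂(b₁₁)`; `θ` is multiplicative with `θ(1) = 1`.
* §2 **`exists_finCongruenceLevel_borelPairChar_eq_one`**: there is `𝔫 ≠ 0` with `θ(ι_f k) = 1` for every `k ∈ K_{U,f}(𝔫)` with `ι_f k ∈ B(𝔸)` — pull the no-small-subgroups
  neighbourhood `V` of `1 ∈ ℂ` (★ `Complex.exists_nhds_one_forall_pow_mem_imp`) back along `θ` to an open `O ∋ 1` of `G(𝔸)`, then along `ι_f` to a neighbourhood of `1 ∈ G(𝔸_f)`,
  which contains some `K_{U,f}(𝔫)` (★ `exists_finCongruenceLevel_subset`); for `k ∈ K_{U,f}(𝔫) ∩ ι_f⁻¹B` all powers stay there, so all powers of `θ(ι_f k)` lie in `V`, so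
  `θ(ι_f k) = 1`.  Packaged: `exists_isOpen_level_borelPairChar_eq_one`.
* §3 **`exists_chiSectionPair_continuous_apply_one_ne_zero`** — THE LEVEL-FREE WITNESS: for unitary `χ₁` and `|χ₂| = 1`, `∃ K′ ω φ, φ ∈ chiSectionSpacePair χ₁ χ₂ K′ ω ∧
  Continuous φ ∧ φ 1 ≠ 0` (★ FILE 3c `…_of_level` at the level of §2).
HONEST LABEL: HC_CM is proved only modulo the 7 printed citations (2 remaining named inputs: hLiu418 = `stmt-HodgeConjecture-24832`, h413 = `stmt-HodgeConjecture-24833`) until rung 0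
closes; REL ≠ ★ ≠ BUILT; this file asserts no named fact and closes no socket — the (V) table row (i) consumer reads §3 BY NAME; count-neutral.

## References
* [PlatonovRapinchuk1994] V. Platonov, A. Rapinchuk, *Algebraic Groups and Number Theory* (1994), §5.1.
* [BorelJacquet1979] A. Borel, H. Jacquet, *Automorphic forms and automorphic representations*, Corvallis PSPM 33.1 (1979), §4.1.
* [MoeglinWaldspurger1995] C. Mœglin, J.-L. Waldspurger, *Spectral Decomposition and Eisenstein Series* (1995), I.2.17.
* [Rogawski1990] J. D. Rogawski, *Automorphic Representations of Unitary Groups in Three Variables* (1990), §1.10.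
-/

set_option autoImplicit false
set_option linter.dupNamespace false  -- the mandated namespace `…HodgeConjecture.HodgeConjecture.R90.S8` (LEAD #1 L1) repeats the summit's segment

noncomputable section

open NumberField IsDedekindDomain Topology Filter
open Literature.NumberTheory.Automorphic Literature.NumberTheory.Automorphic.UnitaryGroup Literature.NumberTheory.GaloisRepresentations AdelicGroupData
open Literature.NumberTheory.Automorphic.Arthur2013.Leaves.TECR
open Summit.HodgeConjecture.HodgeConjecture.Cruxes.H413.K2E1CharacterEisensteinU2Defs
open Summit.HodgeConjecture.HodgeConjecture.Cruxes.H413.K2E1CharacterEisensteinU3PairDefs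
open Summit.HodgeConjecture.HodgeConjecture.Cruxes.H413.K2E1ChiSectionSpaceU3PairDefs

namespace Summit.HodgeConjecture.HodgeConjecture.R90.S8

variable (L : Type) [Field L] [NumberField L] [IsCMField L]

/-! ## §1 The Borel pair character `θ(b) = χ₁(b₀₀)·χ₂(b₁₁)` on `B(𝔸)`: continuity and multiplicativity -/

/-- **`b ↦ bᵢᵢ ∈ 𝔸_Lˣ` is continuous on `B(𝔸)`** (idele topology: the entries of `b` AND of `b⁻¹` are continuous). [cite: Rogawski1990, §1.10] -/
theorem continuous_diagEntryUnit_borel (i : Fin 3) :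
    Continuous fun b : ↥(borelAdelic (↥(maximalRealSubfield L)) L (IsCMField.complexConj L) 3) => diagEntryUnit b.2 i := by
  have hmat : Continuous fun g : (quasiSplit (↥(maximalRealSubfield L)) L (IsCMField.complexConj L) 3).Adelic =>
      ((adelicVal (↥(maximalRealSubfield L)) L (IsCMField.complexConj L) 3 ((StdForm.antidiagonal 3).over L) g : GL (Fin 3) (AdeleRing (𝓞 L) L)) :
        Matrix (Fin 3) (Fin 3) (AdeleRing (𝓞 L) L)) :=
    Units.continuous_val.comp continuous_subtype_val
  refine Units.continuous_iff.2 ⟨?_, ?_⟩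
  · exact (hmat.comp continuous_subtype_val).matrix_elem i i
  · change Continuous fun b : ↥(borelAdelic (↥(maximalRealSubfield L)) L (IsCMField.complexConj L) 3) =>
      ((adelicVal (↥(maximalRealSubfield L)) L (IsCMField.complexConj L) 3 ((StdForm.antidiagonal 3).over L)
        ((b : (quasiSplit (↥(maximalRealSubfield L)) L (IsCMField.complexConj L) 3).Adelic)⁻¹) : GL (Fin 3) (AdeleRing (𝓞 L) L)) :
          Matrix (Fin 3) (Fin 3) (AdeleRing (𝓞 L) L)) i i
    exact (hmat.comp continuous_subtype_val.inv).matrix_elem i i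

/-- `b ↦ b₀₀ ∈ 𝔸_Lˣ` is continuous on `B(𝔸)` (`firstEntryUnit = diagEntryUnit · 0` as ideles). [cite: Rogawski1990, §1.10] -/
theorem continuous_firstEntryUnit_borel :
    Continuous fun b : ↥(borelAdelic (↥(maximalRealSubfield L)) L (IsCMField.complexConj L) 3) => firstEntryUnit b.2 :=
  (continuous_diagEntryUnit_borel L 0).congr fun b => (firstEntryUnit_eq_diagEntryUnit_zero b.2).symm

/-- `b ↦ b₁₁ ∈ T(𝔸_{L⁺})` is continuous on `B(𝔸)` (into `U(1)(𝔸)` by §1, then ★ `continuous_adelicOneEquivTorus`). [cite: Rogawski1990, §1.10] -/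
theorem continuous_middleEntryUnitary_borel :
    Continuous fun b : ↥(borelAdelic (↥(maximalRealSubfield L)) L (IsCMField.complexConj L) 3) => middleEntryUnitary b.2 := by
  have h1 : Continuous fun b : ↥(borelAdelic (↥(maximalRealSubfield L)) L (IsCMField.complexConj L) 3) => middleEntryOne b.2 :=
    continuous_induced_rng.2 ((continuous_diagEntryUnit_borel L 1).congr fun b => (coe_middleEntryOne b.2).symm)
  exact (continuous_adelicOneEquivTorus (↥(maximalRealSubfield L)) L (IsCMField.complexConj L)).comp h1

/-- **The Borel pair character `θ(b) = χ₁(b₀₀)·χ₂(b₁₁)` is continuous on `B(𝔸)`.** [cite: Rogawski1990, §1.10] [cite: MoeglinWaldspurger1995, I.2.17] -/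
theorem continuous_borelPairChar (χ₁ : HeckeCharacter L) (χ₂ : ↥(TorusDict.torus (IsCMField.complexConj L)) →ₜ* ℂˣ) :
    Continuous fun b : ↥(borelAdelic (↥(maximalRealSubfield L)) L (IsCMField.complexConj L) 3) =>
      ((χ₁ (firstEntryUnit b.2) : ℂˣ) : ℂ) * ((χ₂ (middleEntryUnitary b.2) : ℂˣ) : ℂ) :=
  (Units.continuous_val.comp ((map_continuous χ₁).comp (continuous_firstEntryUnit_borel L))).mul
    (Units.continuous_val.comp ((map_continuous χ₂).comp (continuous_middleEntryUnitary_borel L)))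

/-- `θ` is multiplicative on `B(𝔸)` (★ `firstEntryUnit_mul`, ★ `middleEntryUnitary_mul`). [cite: Rogawski1990, §1.10] -/
theorem borelPairChar_mul (χ₁ : HeckeCharacter L) (χ₂ : ↥(TorusDict.torus (IsCMField.complexConj L)) →ₜ* ℂˣ)
    (b b' : ↥(borelAdelic (↥(maximalRealSubfield L)) L (IsCMField.complexConj L) 3)) :
    ((χ₁ (firstEntryUnit (b * b').2) : ℂˣ) : ℂ) * ((χ₂ (middleEntryUnitary (b * b').2) : ℂˣ) : ℂ) =
      (((χ₁ (firstEntryUnit b.2) : ℂˣ) : ℂ) * ((χ₂ (middleEntryUnitary b.2) : ℂˣ) : ℂ)) *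
        (((χ₁ (firstEntryUnit b'.2) : ℂˣ) : ℂ) * ((χ₂ (middleEntryUnitary b'.2) : ℂˣ) : ℂ)) := by
  have h1 : firstEntryUnit (b * b').2 = firstEntryUnit b.2 * firstEntryUnit b'.2 := firstEntryUnit_mul b.2 b'.2
  have h2 : middleEntryUnitary (b * b').2 = middleEntryUnitary b.2 * middleEntryUnitary b'.2 := middleEntryUnitary_mul b.2 b'.2
  rw [h1, h2, map_mul, map_mul, Units.val_mul, Units.val_mul]
  ring

/-- `θ(bᵐ) = θ(b)ᵐ`. [cite: Rogawski1990, §1.10] -/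
theorem borelPairChar_pow (χ₁ : HeckeCharacter L) (χ₂ : ↥(TorusDict.torus (IsCMField.complexConj L)) →ₜ* ℂˣ)
    (b : ↥(borelAdelic (↥(maximalRealSubfield L)) L (IsCMField.complexConj L) 3)) (m : ℕ) :
    ((χ₁ (firstEntryUnit (b ^ m).2) : ℂˣ) : ℂ) * ((χ₂ (middleEntryUnitary (b ^ m).2) : ℂˣ) : ℂ) =
      (((χ₁ (firstEntryUnit b.2) : ℂˣ) : ℂ) * ((χ₂ (middleEntryUnitary b.2) : ℂˣ) : ℂ)) ^ m := by
  induction m with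
  | zero =>
    have h0 : ((b ^ 0 : ↥(borelAdelic (↥(maximalRealSubfield L)) L (IsCMField.complexConj L) 3)) :
        (quasiSplit (↥(maximalRealSubfield L)) L (IsCMField.complexConj L) 3).Adelic) = 1 := by
      rw [pow_zero]; rfl
    have h1 : firstEntryUnit (b ^ 0).2 = 1 := (firstEntryUnit_congr L h0 (b ^ 0).2 (Subgroup.one_mem _)).trans firstEntryUnit_one
    have h2 : middleEntryUnitary (b ^ 0).2 = 1 := (middleEntryUnitary_congr L h0 (b ^ 0).2 (Subgroup.one_mem _)).trans middleEntryUnitary_one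
    rw [h1, h2, map_one, map_one, Units.val_one, pow_zero, mul_one]
  | succ m ih =>
    have h := borelPairChar_mul L χ₁ χ₂ (b ^ m) b
    rw [← pow_succ] at h
    rw [h, ih, pow_succ]

/-! ## §2 The conductor level -/

/-- **A CONDUCTOR LEVEL FOR THE BOREL PAIR CHARACTER**: there is `𝔫 ≠ 0` such that `χ₁(k₀₀)·χ₂(k₁₁) = 1` for every `k ∈ K_{U,f}(𝔫)` with `ι_f k ∈ B(𝔸)` (no small subgroups of `ℂˣ` ★
`Complex.exists_nhds_one_forall_pow_mem_imp` + the level basis ★ `exists_finCongruenceLevel_subset` + §1). [cite: PlatonovRapinchuk1994, §5.1] [cite: MoeglinWaldspurger1995, I.2.17] -/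
theorem exists_finCongruenceLevel_borelPairChar_eq_one (χ₁ : HeckeCharacter L) (χ₂ : ↥(TorusDict.torus (IsCMField.complexConj L)) →ₜ* ℂˣ) :
    ∃ 𝔫 : Ideal (𝓞 L), 𝔫 ≠ 0 ∧
      ∀ k ∈ finCongruenceLevel (↥(maximalRealSubfield L)) L (IsCMField.complexConj L) 3 ((StdForm.antidiagonal 3).over L) 𝔫,
        ∀ (hk : finAdelicToAdelic (↥(maximalRealSubfield L)) L (IsCMField.complexConj L) 3 ((StdForm.antidiagonal 3).over L) k ∈
          borelAdelic (↥(maximalRealSubfield L)) L (IsCMField.complexConj L) 3),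
        ((χ₁ (firstEntryUnit hk) : ℂˣ) : ℂ) * ((χ₂ (middleEntryUnitary hk) : ℂˣ) : ℂ) = 1 := by
  obtain ⟨V, hV, hVpow⟩ := Complex.exists_nhds_one_forall_pow_mem_imp
  have hθ1 : ((χ₁ (firstEntryUnit (1 : ↥(borelAdelic (↥(maximalRealSubfield L)) L (IsCMField.complexConj L) 3)).2) : ℂˣ) : ℂ) *
      ((χ₂ (middleEntryUnitary (1 : ↥(borelAdelic (↥(maximalRealSubfield L)) L (IsCMField.complexConj L) 3)).2) : ℂˣ) : ℂ) = 1 := by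
    have h1 : firstEntryUnit (1 : ↥(borelAdelic (↥(maximalRealSubfield L)) L (IsCMField.complexConj L) 3)).2 = 1 := firstEntryUnit_one
    have h2 : middleEntryUnitary (1 : ↥(borelAdelic (↥(maximalRealSubfield L)) L (IsCMField.complexConj L) 3)).2 = 1 := middleEntryUnitary_one
    rw [h1, h2, map_one, map_one, Units.val_one, mul_one]
  -- `θ ⁻¹' V` is a neighbourhood of `1` in `B(𝔸)`; write it as the trace of a neighbourhood `O` of `1` in `G(𝔸)`
  have hpre : (fun b : ↥(borelAdelic (↥(maximalRealSubfield L)) L (IsCMField.complexConj L) 3) =>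
      ((χ₁ (firstEntryUnit b.2) : ℂˣ) : ℂ) * ((χ₂ (middleEntryUnitary b.2) : ℂˣ) : ℂ)) ⁻¹' V ∈
        𝓝 (1 : ↥(borelAdelic (↥(maximalRealSubfield L)) L (IsCMField.complexConj L) 3)) :=
    (continuous_borelPairChar L χ₁ χ₂).continuousAt.preimage_mem_nhds (by rwa [hθ1])
  rw [nhds_subtype, Filter.mem_comap] at hpre
  obtain ⟨O, hO, hOV⟩ := hpre
  have hO1 : O ∈ 𝓝 (1 : (quasiSplit (↥(maximalRealSubfield L)) L (IsCMField.complexConj L) 3).Adelic) := by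
    simpa only [OneMemClass.coe_one] using hO
  -- pull `O` back to `G(𝔸_f)` and shrink to a principal finite congruence level
  have hOf : (finAdelicToAdelic (↥(maximalRealSubfield L)) L (IsCMField.complexConj L) 3 ((StdForm.antidiagonal 3).over L)) ⁻¹' O ∈
      𝓝 (1 : ↥(finAdelic (↥(maximalRealSubfield L)) L (IsCMField.complexConj L) 3 ((StdForm.antidiagonal 3).over L))) :=
    (continuous_finAdelicToAdelic (↥(maximalRealSubfield L)) L (IsCMField.complexConj L) 3 ((StdForm.antidiagonal 3).over L)).continuousAt.preimage_mem_nhds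
      (by rwa [map_one])
  obtain ⟨𝔫, h𝔫, hsub⟩ := exists_finCongruenceLevel_subset hOf
  refine ⟨𝔫, h𝔫, fun k hk hkB => hVpow _ fun m => ?_⟩
  -- all powers of `θ(ι_f k)` lie in `V`: `θ(ι_f k)ᵐ = θ((ι_f k)ᵐ) = θ(ι_f (kᵐ))` with `kᵐ ∈ K_{U,f}(𝔫) ⊆ ι_f⁻¹ O`
  have hkO : ((⟨_, hkB⟩ ^ m : ↥(borelAdelic (↥(maximalRealSubfield L)) L (IsCMField.complexConj L) 3)) :
      (quasiSplit (↥(maximalRealSubfield L)) L (IsCMField.complexConj L) 3).Adelic) ∈ O := by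
    rw [SubgroupClass.coe_pow]
    show (finAdelicToAdelic (↥(maximalRealSubfield L)) L (IsCMField.complexConj L) 3 ((StdForm.antidiagonal 3).over L) k) ^ m ∈ O
    rw [← map_pow]
    exact hsub (Subgroup.pow_mem _ hk m)
  have hmem : ((χ₁ (firstEntryUnit (⟨_, hkB⟩ ^ m : ↥(borelAdelic (↥(maximalRealSubfield L)) L (IsCMField.complexConj L) 3)).2) : ℂˣ) : ℂ) *
      ((χ₂ (middleEntryUnitary (⟨_, hkB⟩ ^ m : ↥(borelAdelic (↥(maximalRealSubfield L)) L (IsCMField.complexConj L) 3)).2) : ℂˣ) : ℂ) ∈ V :=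
    hOV (show (⟨_, hkB⟩ ^ m : ↥(borelAdelic (↥(maximalRealSubfield L)) L (IsCMField.complexConj L) 3)) ∈ Subtype.val ⁻¹' O from hkO)
  rw [borelPairChar_pow L χ₁ χ₂ ⟨_, hkB⟩ m] at hmem
  exact hmem

/-- Packaged: **an OPEN level `K_f ≤ G(𝔸_f)` on whose Borel elements the pair character is trivial** — the datum `(Kf, hKo, hKχ)` of ★ FILE 2 ∕ FILE 3c. [cite: PlatonovRapinchuk1994, §5.1] -/
theorem exists_isOpen_level_borelPairChar_eq_one (χ₁ : HeckeCharacter L) (χ₂ : ↥(TorusDict.torus (IsCMField.complexConj L)) →ₜ* ℂˣ) :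
    ∃ Kf : Subgroup ↥(finAdelic (↥(maximalRealSubfield L)) L (IsCMField.complexConj L) 3 ((StdForm.antidiagonal 3).over L)),
      IsOpen ((Kf : Subgroup ↥(finAdelic (↥(maximalRealSubfield L)) L (IsCMField.complexConj L) 3 ((StdForm.antidiagonal 3).over L))) :
        Set ↥(finAdelic (↥(maximalRealSubfield L)) L (IsCMField.complexConj L) 3 ((StdForm.antidiagonal 3).over L))) ∧
      ∀ k ∈ Kf, ∀ (hk : finAdelicToAdelic (↥(maximalRealSubfield L)) L (IsCMField.complexConj L) 3 ((StdForm.antidiagonal 3).over L) k ∈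
          borelAdelic (↥(maximalRealSubfield L)) L (IsCMField.complexConj L) 3),
        ((χ₁ (firstEntryUnit hk) : ℂˣ) : ℂ) * ((χ₂ (middleEntryUnitary hk) : ℂˣ) : ℂ) = 1 := by
  obtain ⟨𝔫, h𝔫, h⟩ := exists_finCongruenceLevel_borelPairChar_eq_one L χ₁ χ₂
  exact ⟨_, isOpen_finCongruenceLevel (↥(maximalRealSubfield L)) L (IsCMField.complexConj L) 3 ((StdForm.antidiagonal 3).over L) h𝔫, h⟩

/-! ## §3 THE LEVEL-FREE WITNESS -/

/-- **THE NON-ZERO `(χ₁,χ₂)`-SECTION** ((V) discharge-table row (i), S8-R136 (3), LEVEL-FREE): for a unitary Hecke character `χ₁` of `L` and a character `χ₂` of `T = U(1)(𝔸_{L⁺})` with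
`|χ₂| = 1`, **`∃ K′ ≤ G(𝔸), ω : K′ →* ℂ, φ ∈ chiSectionSpacePair χ₁ χ₂ K′ ω` continuous with `φ(1) ≠ 0`** — ★ FILE 3c `exists_chiSectionPair_continuous_apply_one_ne_zero_of_level` at the
conductor level of §2. [cite: BorelJacquet1979, §4.1] [cite: MoeglinWaldspurger1995, I.2.17] [cite: Rogawski1990, §1.10] -/
theorem exists_chiSectionPair_continuous_apply_one_ne_zero (χ₁ : HeckeCharacter L) (χ₂ : ↥(TorusDict.torus (IsCMField.complexConj L)) →ₜ* ℂˣ)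
    (hχ₁u : χ₁.IsUnitary) (hχ₂u : ∀ u, ‖((χ₂ u : ℂˣ) : ℂ)‖ = 1) :
    ∃ (K' : Subgroup (quasiSplit (↥(maximalRealSubfield L)) L (IsCMField.complexConj L) 3).Adelic) (ω : ↥K' →* ℂ)
      (φ : (quasiSplit (↥(maximalRealSubfield L)) L (IsCMField.complexConj L) 3).Adelic → ℂ),
      φ ∈ chiSectionSpacePair χ₁ χ₂ K' (ω : ↥K' → ℂ) ∧ Continuous φ ∧ φ 1 ≠ 0 := by
  obtain ⟨Kf, hKo, hKχ⟩ := exists_isOpen_level_borelPairChar_eq_one L χ₁ χ₂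
  exact exists_chiSectionPair_continuous_apply_one_ne_zero_of_level L χ₁ χ₂ hχ₁u hχ₂u Kf hKo hKχ

end Summit.HodgeConjecture.HodgeConjecture.R90.S8

end
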